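import Mathlib
import Summits.NavierStokesRegularity.NavierStokesRegularity.Theorems.EulerZoomLiouvillePowerGaugeEulerLiouvilleWindowFlux
import Summits.NavierStokesRegularity.NavierStokesRegularity.Theorems.EulerZoomLiouvillePowerGaugeEulerLiouvilleEnergyVanishingTools
import HarnessLib

/-!
# The GLOBAL (Leray) energy inequality in Seregin's power-gauged ancient Euler class
# (crux `EulerZoomLiouville.PowerGaugeEulerLiouville` = stmt-NavierStokesRegularity-19832, lead's line `birth`)

Route `EulerZoomLiouville` (NavierStokesRegularity).  The crux E: an ancient suitable weak Euler flow on
`(−∞,0) × ℝ³` in Seregin's power-gauged class `a^{2ρ} A(a) + a^ρ E(a) + a^{2ρ} D(a) ≤ c` (all `a > 0`)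
vanishes — OPEN on `0 < ρ ≤ 1/2`.  Companion to `…EnergyVanishing.lean` (stratum «energy-quiescent past»):
the same cut-off/flux mechanism gives the TOTAL-energy inequality of the class.

* `lintegral_enorm_sq_antitone_ae_of_windowFlux` — **class member (any `ρ`) + finite WINDOW flux
  `(|u|³+2|p||u|)/max(1,|x|) ∈ L¹((a,b) × ℝ³)` ⇒ for a.e. `s < 0` and then a.e. `t ∈ (s,0)`:
  `∫_{ℝ³} |u(t)|² ≤ ∫_{ℝ³} |u(s)|²`** (in `ℝ≥0∞`, so vacuous exactly when the energy at `s` is infinite):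
  energy is never created, and at finite total energy none can enter from spatial infinity (the far-window
  flux through `{|x| ≈ R}` over `(s,t)` vanishes as `R → ∞`).  Mechanism: the sliced local energy inequality
  from a.e. start (tree `SuitableRestart.ae_energy_le_of_start_Ioo`, `ν = 0`) against the cut-offs `φ_R`,
  `e_R(t) ≤ e_R(s) + 2C ∫_{(s,t)×{|x|≥R}} (|u|³+2|p||u|)/max(1,|x|)`, `R → ∞`, then `sup_R`.
* `powerGauge_energy_antitone_ae` — the same for every member with `2/5 < ρ`, UNCONDITIONALLY (window flux
  from `windowFlux_integrableOn_of_gauge`).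
* `powerGauge_half_energy_bounded_antitone` — **ENDPOINT `ρ = 1/2` (energy-conserving scaling `α = 3/2`):
  the total energy of every member is finite, `≤ c` at every time (`lintegral_enorm_sq_le_of_gauge_half`),
  and a.e. non-increasing.**  With `…EnergyVanishingEndpoint.lean`: a member is trivial iff its energy is
  essentially small in every far past; a nontrivial endpoint member has an energy level
  `E(−∞) = ess sup_s ‖u(s)‖²₂ ∈ (0, c]` that it carries from `t = −∞` and can only dissipate (exactly
  self-similar candidates `u = (−τ)^{-3/5} V((−τ)^{-2/5} y)`: `‖u(τ)‖₂ = ‖V‖₂` constant).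

WHAT THIS IS NOT: not NS regularity, not the open core `stub_noCollapseFromZero`; structure of the class,
kernel-checked, `--supports` stmt-19832. [folklore]
-/

noncomputable section

set_option linter.dupNamespace false

open MeasureTheory Set Filter Topology Metric Function TopologicalSpace
open scoped ENNReal NNReal InnerProductSpace RealInnerProductSpace Laplacian

namespace Summit.NavierStokesRegularity.NavierStokesRegularity.Theorems.PowerGaugeEulerLiouville

open Literature.Analysis Literature.Analysis.FunctionSpaces Literature.Analysis.FluidPDE

/-- **The global energy inequality of the power-gauged class under finite window flux.**  Let `(u, p)` be
a suitable weak Euler flow on `(−∞,0) × ℝ³` with weak gradient `H` in Seregin's gauged class (any `ρ`) whose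
weighted Euler flux `(|u|³ + 2|p||u|)/max(1,|x|)` is integrable on every finite window `(a,b) × ℝ³`
(`a < b < 0`).  Then for a.e. `s < 0` and then a.e. `t ∈ (s, 0)`: `∫_{ℝ³} |u(t)|² ≤ ∫_{ℝ³} |u(s)|²` (extended
reals).  See the file docstring for the mechanism. [folklore] -/
theorem lintegral_enorm_sq_antitone_ae_of_windowFlux {ρ : ℝ}
    {u : ℝ → EuclideanSpace ℝ (Fin 3) → EuclideanSpace ℝ (Fin 3)} {p : ℝ → EuclideanSpace ℝ (Fin 3) → ℝ}
    {H : ℝ → EuclideanSpace ℝ (Fin 3) → EuclideanSpace ℝ (Fin 3) →L[ℝ] EuclideanSpace ℝ (Fin 3)} {c : ℝ≥0}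
    (hsw : IsSuitableWeakSolutionOn (slab (EuclideanSpace ℝ (Fin 3)) (Iio 0) isOpen_Iio) 0 0 u p)
    (hH : HasWeakSpatialGradientOn (slab (EuclideanSpace ℝ (Fin 3)) (Iio 0) isOpen_Iio) u H)
    (hc : ∀ a : ℝ, 0 < a → ENNReal.ofReal (a ^ (2 * ρ)) * cknA a (0 : ℝ × EuclideanSpace ℝ (Fin 3)) u +
        ENNReal.ofReal (a ^ ρ) * cknE a (0 : ℝ × EuclideanSpace ℝ (Fin 3)) H +
        ENNReal.ofReal (a ^ (2 * ρ)) * cknD a (0 : ℝ × EuclideanSpace ℝ (Fin 3)) p ≤ (c : ℝ≥0∞))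
    (hwin : ∀ a b : ℝ, a < b → b < 0 → IntegrableOn
      (fun z : ℝ × EuclideanSpace ℝ (Fin 3) => (‖u z.1 z.2‖ ^ 3 + 2 * |p z.1 z.2| * ‖u z.1 z.2‖) / max 1 ‖z.2‖)
      (Ioo a b ×ˢ (univ : Set (EuclideanSpace ℝ (Fin 3)))) volume) :
    ∀ᵐ s ∂(volume : Measure ℝ), s < 0 → ∀ᵐ t ∂(volume : Measure ℝ), t ∈ Ioo s 0 →
      ∫⁻ x, ‖u t x‖ₑ ^ 2 ≤ ∫⁻ x, ‖u s x‖ₑ ^ 2 := by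
  have hE : ∀ a : ℝ, 0 < a →
      ENNReal.ofReal (a ^ ρ) * cknE a (0 : ℝ × EuclideanSpace ℝ (Fin 3)) H ≤ (c : ℝ≥0∞) :=
    fun a ha => le_trans (le_trans le_add_self le_self_add) (hc a ha)
  have hA := hasScaledLocalEnergyBound_of_gaugeA (ρ := ρ)
    (fun a ha => le_trans (le_trans le_self_add le_self_add) (hc a ha))
  have hu3 := locallyIntegrableOn_cube_of_gauge hsw hH hE
  obtain ⟨C, hC0, hcut⟩ := cutoffFacts
  set Rk : ℕ → ℝ := fun k => (k : ℝ) + 1 with hRk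
  have hRk1 : ∀ k, 1 ≤ Rk k := fun k => by simp only [hRk]; linarith [(Nat.cast_nonneg k : (0 : ℝ) ≤ k)]
  have hRk0 : ∀ k, 0 < Rk k := fun k => lt_of_lt_of_le one_pos (hRk1 k)
  set φ : ℕ → EuclideanSpace ℝ (Fin 3) → ℝ := fun k => cutoff (Rk k) with hφdef
  have hφ : ∀ k, ContDiff ℝ (⊤ : ℕ∞) (φ k) := fun k => (hcut (Rk k) (hRk0 k)).1
  have hφc : ∀ k, HasCompactSupport (φ k) := fun k => (hcut (Rk k) (hRk0 k)).2.1
  have hφ0 : ∀ k x, 0 ≤ φ k x := fun k => (hcut (Rk k) (hRk0 k)).2.2.1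
  have hφ1 : ∀ k x, φ k x ≤ 1 := fun k => (hcut (Rk k) (hRk0 k)).2.2.2.1
  have hφone : ∀ k, ∀ x ∈ ball (0 : EuclideanSpace ℝ (Fin 3)) (Rk k), φ k x = 1 :=
    fun k => (hcut (Rk k) (hRk0 k)).2.2.2.2.1
  have hφin : ∀ k, ∀ x ∈ ball (0 : EuclideanSpace ℝ (Fin 3)) (Rk k), gradient (φ k) x = 0 :=
    fun k => (hcut (Rk k) (hRk0 k)).2.2.2.2.2.1
  have hφsupp : ∀ k x, φ k x ≠ 0 → x ∈ ball (0 : EuclideanSpace ℝ (Fin 3)) (2 * Rk k + 1) :=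
    fun k => (hcut (Rk k) (hRk0 k)).2.2.2.2.2.2.1
  have hφgrad : ∀ k (x v : EuclideanSpace ℝ (Fin 3)), |⟪v, gradient (φ k) x⟫| ≤ C / Rk k * ‖v‖ :=
    fun k => (hcut (Rk k) (hRk0 k)).2.2.2.2.2.2.2.1
  have hφout : ∀ k (x : EuclideanSpace ℝ (Fin 3)), 2 * Rk k < ‖x‖ → gradient (φ k) x = 0 :=
    fun k => (hcut (Rk k) (hRk0 k)).2.2.2.2.2.2.2.2
  set g : ℝ × EuclideanSpace ℝ (Fin 3) → ℝ :=
    fun z => (‖u z.1 z.2‖ ^ 3 + 2 * |p z.1 z.2| * ‖u z.1 z.2‖) / max 1 ‖z.2‖ with hgdef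
  have hg0 : ∀ z, 0 ≤ g z := fun z => by simp only [hgdef]; positivity
  -- the far-window flux bound `Δ_k(s₀,t)`
  set Dl : ℕ → ℝ → ℝ → ℝ := fun k s₀ t =>
    2 * C * ∫ z in Ico s₀ t ×ˢ {x : EuclideanSpace ℝ (Fin 3) | Rk k ≤ ‖x‖}, g z with hDldef
  have hgIco : ∀ s₀ t : ℝ, t < 0 →
      IntegrableOn g (Ico s₀ t ×ˢ (univ : Set (EuclideanSpace ℝ (Fin 3)))) volume := by
    intro s₀ t ht
    by_cases hst : s₀ < t
    · exact (hwin (s₀ - 1) t (by linarith) ht).mono_set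
        (prod_mono (fun τ hτ => ⟨by linarith [hτ.1], hτ.2⟩) Subset.rfl)
    · rw [Ico_eq_empty hst, empty_prod]
      exact integrableOn_empty
  have hDllim : ∀ s₀ t : ℝ, t < 0 → Tendsto (fun k : ℕ => Dl k s₀ t) atTop (𝓝 0) := by
    intro s₀ t ht
    have h := (tendsto_setIntegral_far_of_integrableOn measurableSet_Ico (hgIco s₀ t ht)).const_mul (2 * C)
    rw [mul_zero] at h
    exact h
  set e : ℕ → ℝ → ℝ := fun k t => ∫ x, ‖u t x‖ ^ 2 * φ k x with hedef
  have hmeasU : AEStronglyMeasurable (uncurry u)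
      (volume.restrict (Iio (0 : ℝ) ×ˢ (univ : Set (EuclideanSpace ℝ (Fin 3))))) := by
    have := hH.locallyIntegrableOn.aestronglyMeasurable
    simpa [slab] using this
  have hmeasP : AEStronglyMeasurable (uncurry p)
      (volume.restrict (Iio (0 : ℝ) ×ˢ (univ : Set (EuclideanSpace ℝ (Fin 3))))) := by
    have := hsw.distributional.2.2.1.aestronglyMeasurable
    simpa [slab] using this
  have hfluxle : ∀ (k : ℕ) (s₀ t : ℝ), t < 0 →
      ∫ z in Ico s₀ t ×ˢ (univ : Set (EuclideanSpace ℝ (Fin 3))),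
        (‖u z.1 z.2‖ ^ 2 * (0 * Δ (φ k) z.2) + (‖u z.1 z.2‖ ^ 2 + 2 * p z.1 z.2) * ⟪u z.1 z.2, gradient (φ k) z.2⟫)
        ≤ Dl k s₀ t := by
    intro k s₀ t ht
    set S : Set (ℝ × EuclideanSpace ℝ (Fin 3)) := Ico s₀ t ×ˢ (univ : Set (EuclideanSpace ℝ (Fin 3))) with hS
    have hSs : S ⊆ Iio (0 : ℝ) ×ˢ (univ : Set (EuclideanSpace ℝ (Fin 3))) :=
      prod_mono (fun τ hτ => lt_of_lt_of_le hτ.2 ht.le) Subset.rfl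
    set F : ℝ × EuclideanSpace ℝ (Fin 3) → ℝ := fun z =>
      ‖u z.1 z.2‖ ^ 2 * (0 * Δ (φ k) z.2) + (‖u z.1 z.2‖ ^ 2 + 2 * p z.1 z.2) * ⟪u z.1 z.2, gradient (φ k) z.2⟫
      with hF
    set T : Set (ℝ × EuclideanSpace ℝ (Fin 3)) := {z | Rk k ≤ ‖z.2‖} with hT
    have hTm : MeasurableSet T := measurableSet_le measurable_const (continuous_snd.norm).measurable
    set B : ℝ × EuclideanSpace ℝ (Fin 3) → ℝ := T.indicator (fun z => 2 * C * g z) with hB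
    have hFB : ∀ z, |F z| ≤ B z := by
      intro z
      have h0 : F z = (‖u z.1 z.2‖ ^ 2 + 2 * p z.1 z.2) * ⟪u z.1 z.2, gradient (φ k) z.2⟫ := by
        simp only [hF, zero_mul, mul_zero, zero_add]
      have := abs_eulerFlux_cutoff_le hC0 (hRk1 k) (hφgrad k) (hφin k) (hφout k) (u z.1 z.2) (p z.1 z.2) z.2
      rw [h0]
      refine this.trans (le_of_eq ?_)
      by_cases hz : Rk k ≤ ‖z.2‖
      · have hzT : z ∈ T := hz
        rw [indicator_of_mem (show z.2 ∈ {y : EuclideanSpace ℝ (Fin 3) | Rk k ≤ ‖y‖} from hz), hB,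
          indicator_of_mem hzT, mul_one]
      · have hzT : z ∉ T := hz
        rw [indicator_of_notMem (show z.2 ∉ {y : EuclideanSpace ℝ (Fin 3) | Rk k ≤ ‖y‖} from hz), hB,
          indicator_of_notMem hzT, mul_zero]
    have hgS : IntegrableOn g S volume := hgIco s₀ t ht
    have hBint : IntegrableOn B S volume := (hgS.const_mul (2 * C)).indicator hTm
    have hB0 : ∀ z, 0 ≤ B z := fun z =>
      indicator_nonneg (fun w _ => mul_nonneg (by positivity) (hg0 w)) _
    have hgradcont : Continuous (gradient (φ k)) := by
      have h1 : Continuous (fderiv ℝ (φ k)) := (hφ k).continuous_fderiv (by simp)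
      exact (InnerProductSpace.toDual ℝ (EuclideanSpace ℝ (Fin 3))).symm.continuous.comp h1
    have hFmeas : AEStronglyMeasurable F (volume.restrict S) := by
      have hu' : AEStronglyMeasurable (uncurry u) (volume.restrict S) :=
        hmeasU.mono_measure (Measure.restrict_mono hSs le_rfl)
      have hp' : AEStronglyMeasurable (uncurry p) (volume.restrict S) :=
        hmeasP.mono_measure (Measure.restrict_mono hSs le_rfl)
      have hgr : AEStronglyMeasurable (fun z : ℝ × EuclideanSpace ℝ (Fin 3) => gradient (φ k) z.2)
          (volume.restrict S) := (hgradcont.comp continuous_snd).aestronglyMeasurable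
      have h1 : AEStronglyMeasurable (fun z : ℝ × EuclideanSpace ℝ (Fin 3) =>
          (‖uncurry u z‖ ^ 2 + 2 * uncurry p z) * ⟪uncurry u z, gradient (φ k) z.2⟫) (volume.restrict S) :=
        ((hu'.norm.pow 2).add (hp'.const_mul 2)).mul (hu'.inner hgr)
      refine h1.congr (Eventually.of_forall fun z => ?_)
      simp only [hF, uncurry, zero_mul, mul_zero, zero_add]
    have hFint : IntegrableOn F S volume :=
      hBint.mono' hFmeas (Eventually.of_forall fun z => by rw [Real.norm_eq_abs]; exact hFB z)
    calc ∫ z in S, F z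
        ≤ ∫ z in S, B z := integral_mono hFint hBint fun z => (le_abs_self _).trans (hFB z)
      _ = Dl k s₀ t := by
          rw [hB, setIntegral_indicator hTm, integral_const_mul]
          have hST : S ∩ T = Ico s₀ t ×ˢ {x : EuclideanSpace ℝ (Fin 3) | Rk k ≤ ‖x‖} := by
            ext z
            simp only [hS, hT, mem_inter_iff, mem_prod, mem_univ, and_true, mem_setOf_eq]
          rw [hST]
  have hslab : ∀ n : ℕ, Ioo (-((n : ℝ) + 2)) 0 ×ˢ (univ : Set (EuclideanSpace ℝ (Fin 3))) ⊆
      ((slab (EuclideanSpace ℝ (Fin 3)) (Iio 0) isOpen_Iio : Opens (ℝ × EuclideanSpace ℝ (Fin 3))) :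
        Set (ℝ × EuclideanSpace ℝ (Fin 3))) := by
    intro n z hz
    rw [SetLike.mem_coe, mem_slab]
    exact hz.1.2
  have hmono : ∀ n k : ℕ, ∀ᵐ s₀ ∂(volume : Measure ℝ), s₀ ∈ Ioo (-((n : ℝ) + 1)) (-(1 / ((n : ℝ) + 1))) →
      ∀ᵐ t ∂(volume : Measure ℝ), t ∈ Ioo s₀ (-(1 / ((n : ℝ) + 1))) → e k t ≤ e k s₀ + Dl k s₀ t := by
    intro n k
    have hn1 : (0 : ℝ) < 1 / ((n : ℝ) + 1) := by positivity
    have h := SuitableRestart.ae_energy_le_of_start_Ioo hsw le_rfl hu3 (hslab n) (hφ k) (hφc k) (hφ0 k)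
      (a' := -((n : ℝ) + 1)) (b' := -(1 / ((n : ℝ) + 1))) (by linarith) (by linarith)
    filter_upwards [h] with s₀ hs₀ hs₀mem
    filter_upwards [hs₀ hs₀mem] with t ht htmem
    have htneg : t < 0 := lt_trans htmem.2 (by linarith)
    exact (ht htmem).trans (add_le_add le_rfl (hfluxle k s₀ t htneg))
  have hreg : ∀ᵐ s ∂(volume : Measure ℝ), s < 0 → AEStronglyMeasurable (u s) volume := by
    have h := ae_hasWeakGradient_slice_of_slab_Iio hH
    rw [ae_restrict_iff' measurableSet_Iio] at h
    filter_upwards [h] with s hs hslt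
    have hl : LocallyIntegrable (u s) volume := locallyIntegrableOn_univ.1 (by
      simpa only [Opens.coe_top] using (hs hslt).locallyIntegrableOn)
    exact hl.aestronglyMeasurable
  set Good : ℝ → Prop := fun s₀ =>
    (∀ n k : ℕ, s₀ ∈ Ioo (-((n : ℝ) + 1)) (-(1 / ((n : ℝ) + 1))) →
      ∀ᵐ t ∂(volume : Measure ℝ), t ∈ Ioo s₀ (-(1 / ((n : ℝ) + 1))) → e k t ≤ e k s₀ + Dl k s₀ t) ∧
    AEStronglyMeasurable (u s₀) volume with hGood
  have hgood : ∀ᵐ s₀ ∂(volume : Measure ℝ), s₀ < 0 → Good s₀ := by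
    have h1 := ae_all_iff.2 fun n => ae_all_iff.2 fun k => hmono n k
    filter_upwards [h1, hreg] with s₀ h1 h2 hs₀
    exact ⟨fun n k => h1 n k, h2 hs₀⟩
  -- ## fix a good start time `s < 0`
  filter_upwards [hgood] with s hs hsneg
  obtain ⟨hsmono, hsreg⟩ := hs hsneg
  -- the inequalities `e_k(t) ≤ e_k(s) + Δ_k(s,t)` for a.e. `t`, all `k`, all windows `n`
  have hall : ∀ᵐ t ∂(volume : Measure ℝ), ∀ n k : ℕ,
      s ∈ Ioo (-((n : ℝ) + 1)) (-(1 / ((n : ℝ) + 1))) →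
        t ∈ Ioo s (-(1 / ((n : ℝ) + 1))) → e k t ≤ e k s + Dl k s t :=
    ae_all_iff.2 fun n => ae_all_iff.2 fun k => by
      by_cases hmem : s ∈ Ioo (-((n : ℝ) + 1)) (-(1 / ((n : ℝ) + 1)))
      · filter_upwards [hsmono n k hmem] with t ht _ htmem
        exact ht htmem
      · exact Eventually.of_forall fun t h => (hmem h).elim
  filter_upwards [hall, hreg] with t ht hregt htmem
  have hst : s < t := htmem.1
  have htneg : t < 0 := htmem.2
  -- nothing to prove if the energy at time `s` is infinite
  by_cases htop : ∫⁻ x, ‖u s x‖ₑ ^ 2 = ⊤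
  · rw [htop]; exact le_top
  set E₀ : ℝ := (∫⁻ x, ‖u s x‖ₑ ^ 2).toReal with hE₀
  have hE₀eq : ENNReal.ofReal E₀ = ∫⁻ x, ‖u s x‖ₑ ^ 2 := ENNReal.ofReal_toReal htop
  -- `e_k(s) ≤ E₀` for every `k`
  have heS : ∀ k : ℕ, e k s ≤ E₀ := by
    intro k
    have hball : ∫⁻ y in ball (0 : EuclideanSpace ℝ (Fin 3)) (2 * Rk k + 1), ‖u s y‖ₑ ^ 2 ≤
        ∫⁻ y, ‖u s y‖ₑ ^ 2 := setLIntegral_le_lintegral _ _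
    have hfin : ∫⁻ y in ball (0 : EuclideanSpace ℝ (Fin 3)) (2 * Rk k + 1), ‖u s y‖ₑ ^ 2 < ⊤ :=
      lt_of_le_of_lt hball (lt_top_iff_ne_top.2 htop)
    obtain ⟨-, hle⟩ := integrable_sq_mul_of_lintegral_ball hsreg hfin (hφ k).continuous (hφ0 k)
      (hφ1 k) (hφsupp k)
    exact hle.trans (ENNReal.toReal_mono htop hball)
  -- a window `n` containing `s` and `t`
  set n : ℕ := ⌈-s⌉₊ + ⌈1 / (-t)⌉₊ with hn
  have hn1 : -((n : ℝ) + 1) < s := by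
    have h1 : -s ≤ (⌈-s⌉₊ : ℝ) := Nat.le_ceil _
    have h2 : (n : ℝ) = (⌈-s⌉₊ : ℝ) + (⌈1 / (-t)⌉₊ : ℝ) := by rw [hn]; push_cast; ring
    have h3 : (0 : ℝ) ≤ (⌈1 / (-t)⌉₊ : ℝ) := by positivity
    linarith
  have hn2 : t < -(1 / ((n : ℝ) + 1)) := by
    have h1 : 1 / (-t) ≤ (⌈1 / (-t)⌉₊ : ℝ) := Nat.le_ceil _
    have h2 : (n : ℝ) = (⌈-s⌉₊ : ℝ) + (⌈1 / (-t)⌉₊ : ℝ) := by rw [hn]; push_cast; ring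
    have h3 : (0 : ℝ) ≤ (⌈-s⌉₊ : ℝ) := by positivity
    have h4 : 1 / (-t) < (n : ℝ) + 1 := by linarith
    have hnt : 0 < -t := by linarith
    rw [div_lt_iff₀ hnt] at h4
    have h5 : 1 / ((n : ℝ) + 1) < -t := by
      rw [div_lt_iff₀ (by positivity), mul_comm]; exact h4
    linarith
  have hsmem : s ∈ Ioo (-((n : ℝ) + 1)) (-(1 / ((n : ℝ) + 1))) := ⟨hn1, hst.trans hn2⟩
  have hekt : ∀ k : ℕ, e k t ≤ E₀ + Dl k s t := fun k =>
    (ht n k hsmem ⟨hst, hn2⟩).trans (add_le_add (heS k) le_rfl)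
  have hmeas := hregt htneg
  have hint : ∀ k : ℕ, Integrable (fun x => ‖u t x‖ ^ 2 * φ k x) volume := by
    intro k
    set a : ℝ := max (2 * Rk k + 1) (Real.sqrt (-t) + 1) with ha
    have ha0 : 0 < a := lt_of_lt_of_le (by linarith [hRk0 k]) (le_max_left _ _)
    have hta : t ∈ Ioo (-(a ^ 2)) 0 := by
      refine ⟨?_, htneg⟩
      have h1 : Real.sqrt (-t) ^ 2 = -t := Real.sq_sqrt (by linarith)
      have h2 : Real.sqrt (-t) + 1 ≤ a := le_max_right _ _
      nlinarith [Real.sqrt_nonneg (-t)]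
    have hfin : ∫⁻ y in ball (0 : EuclideanSpace ℝ (Fin 3)) (2 * Rk k + 1), ‖u t y‖ₑ ^ 2 < ⊤ :=
      lt_of_le_of_lt (lintegral_mono_set (ball_subset_ball (le_max_left _ _)))
        (lt_of_le_of_lt (hA a ha0 t hta) ENNReal.ofReal_lt_top)
    exact (integrable_sq_mul_of_lintegral_ball hmeas hfin (hφ k).continuous (hφ0 k) (hφ1 k) (hφsupp k)).1
  have hejk : ∀ j k : ℕ, 2 * j + 2 ≤ k → e j t ≤ e k t := by
    intro j k hjk
    refine integral_mono (hint j) (hint k) fun x => ?_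
    refine mul_le_mul_of_nonneg_left ?_ (sq_nonneg _)
    by_cases hx : φ j x = 0
    · rw [hx]; exact hφ0 k x
    · have h1 := hφsupp j x hx
      have h2 : x ∈ ball (0 : EuclideanSpace ℝ (Fin 3)) (Rk k) := by
        rw [mem_ball_zero_iff] at h1 ⊢
        have : 2 * Rk j + 1 ≤ Rk k := by
          simp only [hRk]
          have : (2 * j + 2 : ℕ) ≤ k := hjk
          have : (2 : ℝ) * j + 2 ≤ k := by exact_mod_cast this
          linarith
        linarith
      rw [hφone k x h2]
      exact hφ1 j x
  -- `e_j(t) ≤ E₀` for every `j`: let `k → ∞` in `e_j(t) ≤ e_k(t) ≤ E₀ + Δ_k(s,t)`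
  have hej : ∀ j : ℕ, e j t ≤ E₀ := by
    intro j
    have hev : ∀ᶠ k : ℕ in atTop, e j t ≤ E₀ + Dl k s t := by
      filter_upwards [eventually_ge_atTop (2 * j + 2)] with k hk
      exact (hejk j k hk).trans (hekt k)
    have hlim : Tendsto (fun k : ℕ => E₀ + Dl k s t) atTop (𝓝 (E₀ + 0)) :=
      tendsto_const_nhds.add (hDllim s t htneg)
    rw [add_zero] at hlim
    exact ge_of_tendsto hlim hev
  -- pass to the total energy at time `t`: `∫ |u(t)|² = sup_j ∫_{B(R_j)} |u(t)|² ≤ E₀`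
  have hballj : ∀ j : ℕ, ∫⁻ x in ball (0 : EuclideanSpace ℝ (Fin 3)) (Rk j), ‖u t x‖ₑ ^ 2 ≤
      ENNReal.ofReal E₀ := by
    intro j
    have hnn : 0 ≤ᵐ[volume] fun x => ‖u t x‖ ^ 2 * φ j x :=
      Eventually.of_forall fun x => mul_nonneg (sq_nonneg _) (hφ0 j x)
    calc ∫⁻ x in ball (0 : EuclideanSpace ℝ (Fin 3)) (Rk j), ‖u t x‖ₑ ^ 2
        = ∫⁻ x in ball (0 : EuclideanSpace ℝ (Fin 3)) (Rk j), ENNReal.ofReal (‖u t x‖ ^ 2 * φ j x) := by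
          refine setLIntegral_congr_fun measurableSet_ball (fun x hx => ?_)
          rw [hφone j x hx, mul_one, ← ofReal_norm, ENNReal.ofReal_pow (norm_nonneg _)]
      _ ≤ ∫⁻ x, ENNReal.ofReal (‖u t x‖ ^ 2 * φ j x) := setLIntegral_le_lintegral _ _
      _ = ENNReal.ofReal (e j t) := (ofReal_integral_eq_lintegral_ofReal (hint j) hnn).symm
      _ ≤ ENNReal.ofReal E₀ := ENNReal.ofReal_le_ofReal (hej j)
  have hcov : (⋃ j : ℕ, ball (0 : EuclideanSpace ℝ (Fin 3)) (Rk j)) = univ := by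
    refine eq_univ_of_forall fun x => ?_
    obtain ⟨j, hj⟩ := exists_nat_gt ‖x‖
    exact mem_iUnion.2 ⟨j, mem_ball_zero_iff.2 (by simp only [hRk]; linarith)⟩
  have hdir : Directed (· ⊆ ·) fun j : ℕ => ball (0 : EuclideanSpace ℝ (Fin 3)) (Rk j) := by
    refine Monotone.directed_le fun i j hij => ball_subset_ball ?_
    simp only [hRk]
    have : (i : ℝ) ≤ j := by exact_mod_cast hij
    linarith
  calc ∫⁻ x, ‖u t x‖ₑ ^ 2
      = ∫⁻ x in (⋃ j : ℕ, ball (0 : EuclideanSpace ℝ (Fin 3)) (Rk j)), ‖u t x‖ₑ ^ 2 := by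
        rw [hcov, Measure.restrict_univ]
    _ = ⨆ j : ℕ, ∫⁻ x in ball (0 : EuclideanSpace ℝ (Fin 3)) (Rk j), ‖u t x‖ₑ ^ 2 :=
        setLIntegral_iUnion_of_directed _ hdir
    _ ≤ ENNReal.ofReal E₀ := iSup_le hballj
    _ = ∫⁻ x, ‖u s x‖ₑ ^ 2 := hE₀eq

/-- **The global energy inequality in Seregin's power-gauged class, unconditionally for `2/5 < ρ`:** for
every member, for a.e. `s < 0` and then a.e. `t ∈ (s,0)`, `∫_{ℝ³}|u(t)|² ≤ ∫_{ℝ³}|u(s)|²` (extended reals).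
The crux's three hypotheses VERBATIM; the window flux comes from `windowFlux_integrableOn_of_gauge`.
[folklore] -/
theorem powerGauge_energy_antitone_ae :
    ∀ ρ : ℝ, 2 / 5 < ρ → ∀ (u : ℝ → EuclideanSpace ℝ (Fin 3) → EuclideanSpace ℝ (Fin 3))
      (p : ℝ → EuclideanSpace ℝ (Fin 3) → ℝ)
      (H : ℝ → EuclideanSpace ℝ (Fin 3) → EuclideanSpace ℝ (Fin 3) →L[ℝ] EuclideanSpace ℝ (Fin 3)) (c : ℝ≥0),
      IsSuitableWeakSolutionOn (slab (EuclideanSpace ℝ (Fin 3)) (Set.Iio 0) isOpen_Iio) 0 0 u p →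
      HasWeakSpatialGradientOn (slab (EuclideanSpace ℝ (Fin 3)) (Set.Iio 0) isOpen_Iio) u H →
      (∀ a : ℝ, 0 < a → ENNReal.ofReal (a ^ (2 * ρ)) * cknA a (0 : ℝ × EuclideanSpace ℝ (Fin 3)) u +
        ENNReal.ofReal (a ^ ρ) * cknE a (0 : ℝ × EuclideanSpace ℝ (Fin 3)) H +
        ENNReal.ofReal (a ^ (2 * ρ)) * cknD a (0 : ℝ × EuclideanSpace ℝ (Fin 3)) p ≤ (c : ℝ≥0∞)) →
      ∀ᵐ s ∂(volume : Measure ℝ), s < 0 → ∀ᵐ t ∂(volume : Measure ℝ), t ∈ Set.Ioo s 0 →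
        ∫⁻ x, ‖u t x‖ₑ ^ 2 ≤ ∫⁻ x, ‖u s x‖ₑ ^ 2 :=
  fun _ hρ _ _ _ _ hsw hH hc =>
    lintegral_enorm_sq_antitone_ae_of_windowFlux hsw hH hc
      (fun _ _ hab hb => windowFlux_integrableOn_of_gauge hρ hsw hH hc hab hb)

/-- **Endpoint `ρ = 1/2`: every member of the class has finite total energy `≤ c` at every time, a.e.
non-increasing in time.**  (`lintegral_enorm_sq_le_of_gauge_half` + `powerGauge_energy_antitone_ae` at
`ρ = 1/2 > 2/5`.)  So a nontrivial endpoint member has an energy level `ess sup_s ‖u(s)‖²₂ ∈ (0, c]` carried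
from `t = −∞` (`…EnergyVanishingEndpoint.lean`), which it can only dissipate. [folklore] -/
theorem powerGauge_half_energy_bounded_antitone
    (u : ℝ → EuclideanSpace ℝ (Fin 3) → EuclideanSpace ℝ (Fin 3)) (p : ℝ → EuclideanSpace ℝ (Fin 3) → ℝ)
    (H : ℝ → EuclideanSpace ℝ (Fin 3) → EuclideanSpace ℝ (Fin 3) →L[ℝ] EuclideanSpace ℝ (Fin 3)) (c : ℝ≥0)
    (hsw : IsSuitableWeakSolutionOn (slab (EuclideanSpace ℝ (Fin 3)) (Set.Iio 0) isOpen_Iio) 0 0 u p)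
    (hH : HasWeakSpatialGradientOn (slab (EuclideanSpace ℝ (Fin 3)) (Set.Iio 0) isOpen_Iio) u H)
    (hc : ∀ a : ℝ, 0 < a → ENNReal.ofReal (a ^ (2 * (1 / 2 : ℝ))) * cknA a (0 : ℝ × EuclideanSpace ℝ (Fin 3)) u +
        ENNReal.ofReal (a ^ (1 / 2 : ℝ)) * cknE a (0 : ℝ × EuclideanSpace ℝ (Fin 3)) H +
        ENNReal.ofReal (a ^ (2 * (1 / 2 : ℝ))) * cknD a (0 : ℝ × EuclideanSpace ℝ (Fin 3)) p ≤ (c : ℝ≥0∞)) :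
    (∀ τ : ℝ, τ < 0 → ∫⁻ x, ‖u τ x‖ₑ ^ 2 ≤ (c : ℝ≥0∞)) ∧
      ∀ᵐ s ∂(volume : Measure ℝ), s < 0 → ∀ᵐ t ∂(volume : Measure ℝ), t ∈ Set.Ioo s 0 →
        ∫⁻ x, ‖u t x‖ₑ ^ 2 ≤ ∫⁻ x, ‖u s x‖ₑ ^ 2 :=
  ⟨fun _ hτ => lintegral_enorm_sq_le_of_gauge_half
      (fun a ha => le_trans (le_trans le_self_add le_self_add) (hc a ha)) hτ,
    powerGauge_energy_antitone_ae (1 / 2) (by norm_num) u p H c hsw hH hc⟩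

end Summit.NavierStokesRegularity.NavierStokesRegularity.Theorems.PowerGaugeEulerLiouville

end
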